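import Summits.QuantumFields.BalabanUV.Beta.RemainderExplicitLinearizationDefectFamily

/-!
# RemainderExplicitLinearizationDefectSigned — ROAD P3: OUTSIDE THE CONE THE EXACT ONE-LOOP LETTER OF THE LINEARIZATION IS THE SIGNED HARMONIC
# TRANSFORM OF THE ONE-LOOP ERRORS (file 4 of the station «the third letter is the linearization defect»: under bounded one-loop increments, the
# QUADRATIC letter `Σ_{j<K} (P(K) − P(j))²∕(K − j)³ ≤ Q₂` and the MIXED letter `Σ_{j<K} |β_{j,2} − β₂||P(K) − P(j)|∕(K − j)² ≤ Q₁`, the defect is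
# `V(K) = (β₂∕β₀²)·Σ_{i<K} (β_{i,0} − β₀)∕(K − i) + O(1)` — N4's functional, SIGNED, on the one-loop errors; N3-ker is its absolute majorant)

Cell `pub-balaban`, BINDER row D4 «RemainderConst leaves for Bałaban's split» (owner lineage `b2b-balaban-beta-an4`; this file by co-owner #3
lineage `b2b-balaban-beta-d4-p3`, road P3 «the reduction road», generation 40; sequel of `RemainderExplicitLinearizationDefect` ∕ `…Family` ∕
`…Witness`), β-FLOW TEAM duty (1); FREEZE (0) honoured (def-free module in road P3's own `RemainderExplicit*` series; no leaf, no interface, no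
Literature file).  SOURCE: [BalabanJaffe1986] Part III §4 p. 250, (3.73)–(3.76), as SHAPES ONLY (typers' bank `beta/ERICE-STATEMENT.md` §C).
THE OCCASION.  Files 1–3 located the linearization defect `V(K) = Σ_{j<K} β_{j,2}(g_j² − 1∕y_j)` as the exact third letter of the bare end, showed it
is the one-loop defect's SIGNED pairing with the run weights, and proved that in the SIGN-COHERENT CONE the kernel letter N3-ker is NECESSARY — leaving
«outside the cone a signed cancellation is possible and not adjudicated» (d4-p2's (E28) «half-cone» then located the open region at «both one-sided
halves of the kernel functional unbounded»).  THIS FILE prices the pairing OUTSIDE the cone to second order: under two explicit summability letters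
(both NOT-IN-PRINT, declared; both implied by the letters already in the tree — the quadratic one by N3-ker with bounded increments, the mixed one
by the two-loop 1∕ln-rate N4 of MY generation 36) the defect equals `(β₂∕β₀²)` times the HARMONIC TRANSFORM `h(K) = Σ_{i<K} (β_{i,0} − β₀)∕(K − i)` of
the one-loop errors up to a displayed O(1) — the SIGNED form of the OWNER's (D4-J14b) price.  So outside the cone the exact one-loop letter of the
linearization is `sup_K |h(K)| < ∞`, and necessity of N3-ker there FAILS exactly if a bounded-increment sequence has bounded signed harmonic
transform, summable `(P(K) − P(j))²∕(K − j)³` and unbounded kernel functional — a statement about ONE real sequence (numerics of this seat and of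
d4-p2 g30 point to backward-dyadic alternating blocks; NOT claimed here).
WHAT THIS FILE PROVES ([folklore] real analysis; file 1 ∕ 2, MY gen-39 `run_representation_kernel`, the OWNER's (D4-J14b) `kernel_eq_weighted` ∕
`le_weight` ∕ `sum_inv_sq_le_two`, MY gen-36 `sum_inv_mul_log_le_four`, prover 1's run lemmas BY NAME; 0 sorry, 0 `def`):
* §1 **`abs_pairing_sub_lineKernel_le`** (one run; records, `|β_{j,2}| ≤ B₂`, increments `|P(K) − P(j)| ≤ Δ₀(K − j)`, the MIXED letter Q₁ and the
  QUADRATIC letter Q₂): `|pairing − β₂·Σ_{j<K} (P(K) − P(j))∕y_j²| ≤ Q₁∕(|β′||β₀|) + |β₂|(Q₂ + Δ₀(3(2B₂∕|β′|) + 2(2C∕β′²)))∕(|β′|β₀²)` — the second-order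
  expansion `g_j²∕y_j = 1∕y_j² + (P(K) − P(j) + tails)·g_j²∕y_j²`.
* §2 **`abs_lineKernel_sub_kernel_le`** (pure): `|Σ_{j<K} D_j∕y_j² − (1∕β₀²)Σ_{j<K} D_j∕(K − j)²| ≤ 2Δ₀(g⁻⁴ + 2g⁻²|β₀|)∕β₀⁴` for `|D_j| ≤ Δ₀(K − j)`.
* §3 `weight_le_sharp` (`Σ_{m=n}^{K} 1∕m² ≤ 1∕n² + 1∕n − 1∕K`, the sharp upper companion of (D4-J14b) `le_weight`), `abs_weight_sub_inv_le`,
  **`abs_signedKernel_sub_harmonic_le`** (`|Σ_{j<K} (Σ_{j≤i<K} δ_i)∕(K − j)² − Σ_{i<K} δ_i∕(K − i)| ≤ 3Δ₀` for `|δ_i| ≤ Δ₀` — Fubini by (D4-J14b)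
  `kernel_eq_weighted`, which holds for SIGNED sequences).
* §4 **`abs_defect_sub_harmonic_le`** (one run: `|V(K) − (β₂∕β₀²)·Σ_{i<K} (β_{i,0} − β₀)∕(K − i)| ≤ R₅`, displayed); over K-families
  **`reprBounded_iff_signedHarmonic`** (β₂ ≠ 0: representation K-uniform ⟺ `∃ H, ∀ K, |Σ_{i<K} (β_{i,0} − β₀)∕(K − i)| ≤ H`);
  `mixedLetter_of_logRate` (two-loop 1∕ln-rate + bounded increments ⟹ Q₁ = 4AΔ₀), `quadratic_le_of_kernel` (Q₂ ≤ Δ₀·Kern); END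
  `linearizationDefectSigned_census`.
HONEST FRAMING (BETA-SPEC §0.2, verbatim and binding). *"Discharging BetaPertH makes Bałaban's UV stability UNCONDITIONAL — a real
constructive-QFT result; it is NOT the continuum limit and NOT the Clay problem."*  THIS MODULE DISCHARGES NOTHING: elementary real analysis on
the typers' SHAPES along hypothetical runs; every Erice sentence is a HYPOTHESIS by name; the quadratic ∕ mixed ∕ signed-harmonic letters, N3-ker and
the representation are NOT-IN-PRINT (p. 250 prints «β_{n,0} → β₀, β_{n,2} → β₂», no rate, no sign), declared; nothing of Bałaban's (1.22) or of
Bałaban–Jaffe's β_n is asserted, constructed or instantiated; row D4 class UNCHANGED (critical-path width 0: THE INSTANCE over NODE O.2 absent;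
instance 0∕1; D4 DISCHARGE NO DATE).  NOT [Balaban1987RG1] Theorem 2, NOT BetaPertH, NOT continuum, NOT Clay.  HONEST DEPENDENCY: continuum YM on T⁴ ⇐
BetaPertH ∧ nine spine estimates (0/9 proved); BetaPertH ⇐ (D1) ∧ (D4) ∧ CAP+tail; G-an2-4 gates asym, D1 and NE2/3/4.
-/

noncomputable section

open Finset Real Filter Topology

namespace Summit.QuantumFields.BalabanUV.Beta.RemainderExplicitLinearizationDefectSigned

open Literature.MathematicalPhysics.QuantumFieldTheory.BalabanJaffe1986.BJ86CouplingRenormalization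
open Literature.MathematicalPhysics.QuantumFieldTheory.Balaban1983to89.T4TwoLoopLaw (sum_inv_mul_sqrt_succ_le)
open Literature.MathematicalPhysics.QuantumLattice (sum_range_one_div_sq_le_two)
open Summit.QuantumFields.BalabanUV.Beta.EriceFlowEnclosureBareCouplingSums (sum_range_reflect_sub)
open Summit.QuantumFields.BalabanUV.Beta.EriceFlowEnclosureBareCouplingRun
  (inv_gsq_eq_sub_tail tail_split abs_tail_twoLoop_le abs_tail_remainder_le gsq_le_of_run taylorConst_nonneg)
open Summit.QuantumFields.BalabanUV.Beta.RemainderExplicitLogRate (sum_inv_mul_log_le_four)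
open Summit.QuantumFields.BalabanUV.Beta.RemainderCouplingKernelModulus (kernel_eq_weighted le_weight sum_inv_sq_le_two)
open Summit.QuantumFields.BalabanUV.Beta.RemainderExplicitWindowKernel (run_representation_kernel)
open Summit.QuantumFields.BalabanUV.Beta.RemainderExplicitLinearizationDefect (run_assembly_defect abs_defect_sub_pairing_le)

/-! ## §1 The pairing to second order: the line kernel, the mixed letter and the quadratic letter -/

/-- **THE PAIRING TO SECOND ORDER, along one run.**  Records ((3.62) ending at g² (3.71), positivity, (3.69) along the run from the bare end, the
n-uniform (3.73), `β₀ < 0`), `|β_{j,2}| ≤ B₂`, bounded one-loop increments `|P(K) − P(j)| ≤ Δ₀(K − j)` (j < K), the MIXED letter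
`Σ_{j<K} |β_{j,2} − β₂|·|P(K) − P(j)|∕(K − j)² ≤ Q₁` and the QUADRATIC letter `Σ_{j<K} (P(K) − P(j))²∕(K − j)³ ≤ Q₂` give
`|Σ_{j<K} β_{j,2} g_j²(P(K) − P(j))∕y_j − β₂·Σ_{j<K} (P(K) − P(j))∕y_j²| ≤ Q₁∕(|β′||β₀|) + |β₂|(Q₂ + Δ₀(3(2B₂∕|β′|) + 2(2C∕β′²)))∕(|β′|β₀²)`: per step
`β_{j,2} g_j² D_j∕y_j − β₂ D_j∕y_j² = (β_{j,2} − β₂) g_j² D_j∕y_j + β₂ D_j g_j²(D_j + tails_j)∕y_j²` exactly (`g_j² y_j − 1 = g_j²(D_j + tails_j)` by (3.70) +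
the split (3.73)), the tails paid as in file 1 §2. [folklore; cite: BalabanJaffe1986, Part III (3.70), (3.73) p.250 — shapes only] -/
theorem abs_pairing_sub_lineKernel_le {βE : ℕ → ℝ → ℝ} {gsq : ℕ → ℝ} {K : ℕ} {g β'' β' : ℝ}
    (h362 : Recursion362 βE gsq K) (h371 : gsq K = g ^ 2) (h369 : AlongRun369 βE gsq β'' β' 0 K)
    (hβ' : β' < 0) (hg : 0 < g) (hpos : ∀ n, n ≤ K → 0 < gsq n)
    {β₀seq β₂seq : ℕ → ℝ} {C s₀ : ℝ} (h373 : TaylorSplit373 βE β₀seq β₂seq C s₀) (hgs₀ : g ^ 2 ≤ s₀)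
    {B₂ : ℝ} (hB₂ : ∀ j, |β₂seq j| ≤ B₂) {β₀ β₂ Δ₀ Q₁ Q₂ : ℝ} (hβ₀ : β₀ < 0) (hΔ0 : 0 ≤ Δ₀)
    (hΔ : ∀ j, j < K → |(∑ i ∈ range K, β₀seq i - β₀ * K) - (∑ i ∈ range j, β₀seq i - β₀ * j)| ≤ Δ₀ * ((K : ℝ) - j))
    (hQ₁ : ∑ j ∈ range K, |β₂seq j - β₂| * |(∑ i ∈ range K, β₀seq i - β₀ * K) - (∑ i ∈ range j, β₀seq i - β₀ * j)| /
      ((K : ℝ) - j) ^ 2 ≤ Q₁)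
    (hQ₂ : ∑ j ∈ range K, ((∑ i ∈ range K, β₀seq i - β₀ * K) - (∑ i ∈ range j, β₀seq i - β₀ * j)) ^ 2 /
      ((K : ℝ) - j) ^ 3 ≤ Q₂) :
    |∑ j ∈ range K, β₂seq j * gsq j *
        ((∑ i ∈ range K, β₀seq i - β₀ * K) - (∑ i ∈ range j, β₀seq i - β₀ * j)) / (1 / g ^ 2 + (-β₀) * ((K : ℝ) - j)) -
      β₂ * ∑ j ∈ range K, ((∑ i ∈ range K, β₀seq i - β₀ * K) - (∑ i ∈ range j, β₀seq i - β₀ * j)) /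
        (1 / g ^ 2 + (-β₀) * ((K : ℝ) - j)) ^ 2| ≤
      Q₁ / ((-β') * (-β₀)) + |β₂| * (Q₂ + Δ₀ * (3 * (2 * B₂ / (-β')) + 2 * (2 * C / β' ^ 2))) / ((-β') * (-β₀) ^ 2) := by
  have hC := taylorConst_nonneg h373 hg hgs₀
  have hB₂0 : 0 ≤ B₂ := le_trans (abs_nonneg _) (hB₂ 0)
  have hb' : 0 < -β' := by linarith
  have hb₀ : 0 < -β₀ := by linarith
  set s : ℝ := 2 * B₂ / (-β') with hs_def
  set r : ℝ := 2 * C / β' ^ 2 with hr_def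
  have hs0 : 0 ≤ s := by positivity
  have hr0 : 0 ≤ r := by positivity
  set P := fun k : ℕ => ∑ i ∈ range k, β₀seq i - β₀ * k with hP
  -- termwise second-order bound
  have hterm : ∀ j ∈ range K,
      |β₂seq j * gsq j * (P K - P j) / (1 / g ^ 2 + (-β₀) * ((K : ℝ) - j)) -
          β₂ * ((P K - P j) / (1 / g ^ 2 + (-β₀) * ((K : ℝ) - j)) ^ 2)| ≤
        1 / ((-β') * (-β₀)) * (|β₂seq j - β₂| * |P K - P j| / ((K : ℝ) - j) ^ 2) +
        |β₂| / ((-β') * (-β₀) ^ 2) * ((P K - P j) ^ 2 / ((K : ℝ) - j) ^ 3) +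
        |β₂| * Δ₀ * s / ((-β') * (-β₀) ^ 2) * (1 / (((K : ℝ) - j) * Real.sqrt ((K : ℝ) - j))) +
        |β₂| * Δ₀ * r / ((-β') * (-β₀) ^ 2) * (1 / ((K : ℝ) - j) ^ 2) := by
    intro j hj
    have hjK := mem_range.mp hj
    have hm : (1 : ℝ) ≤ (K : ℝ) - j := by
      have : (j : ℝ) + 1 ≤ K := by exact_mod_cast hjK
      linarith
    have hm0 : (0 : ℝ) < (K : ℝ) - j := by linarith
    have hp := hpos j hjK.le
    set m : ℝ := (K : ℝ) - j with hm_def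
    set y : ℝ := 1 / g ^ 2 + (-β₀) * m with hy_def
    have hy : 0 < y := by positivity
    set D : ℝ := P K - P j with hD_def
    set S₂ := ∑ i ∈ Ico j K, β₂seq i * gsq i with hS₂
    set Rm := ∑ i ∈ Ico j K, (βE i (gsq i) - β₀seq i - β₂seq i * gsq i) with hRm
    have hF := inv_gsq_eq_sub_tail h362 h371 hjK.le
    rw [tail_split β₀seq β₂seq β₀ hjK.le] at hF
    have hx : 1 / gsq j = y - (D + S₂ + Rm) := by
      rw [hF, hy_def, hD_def, hP, hS₂, hRm]; ring
    have e3 : gsq j * (D + S₂ + Rm) = gsq j * y - 1 := by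
      have e2 : D + S₂ + Rm = y - 1 / gsq j := by linarith
      rw [e2, mul_sub, mul_one_div_cancel hp.ne']
    have key : β₂seq j * gsq j * D / y - β₂ * (D / y ^ 2) =
        (β₂seq j - β₂) * gsq j * D / y + β₂ * (D * (gsq j * (D + S₂ + Rm)) / y ^ 2) := by
      rw [e3]
      field_simp
      ring
    rw [key]
    -- the tails and the run weights
    have hS₂b : |S₂| ≤ s * Real.sqrt m := abs_tail_twoLoop_le h362 h371 h369 hβ' hg hpos hB₂ hjK.le
    have hRmb : |Rm| ≤ r := abs_tail_remainder_le h362 h371 h369 hβ' hg hpos h373 hgs₀ hjK.le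
    have hgs : gsq j ≤ 1 / ((-β') * m) := (gsq_le_of_run h362 h371 h369 hβ' hg hpos hjK).1
    have hyinv : 1 / y ≤ 1 / ((-β₀) * m) :=
      one_div_le_one_div_of_le (by positivity) (by rw [hy_def]; linarith [(by positivity : (0 : ℝ) ≤ 1 / g ^ 2)])
    have hy2 : 1 / y ^ 2 ≤ 1 / ((-β₀) * m) ^ 2 := by
      have h0 : 0 ≤ 1 / y := by positivity
      calc 1 / y ^ 2 = (1 / y) ^ 2 := by rw [one_div_pow]
        _ ≤ (1 / ((-β₀) * m)) ^ 2 := pow_le_pow_left₀ h0 hyinv 2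
        _ = 1 / ((-β₀) * m) ^ 2 := by rw [one_div_pow]
    have hDm := hΔ j hjK
    have hsq : Real.sqrt m * Real.sqrt m = m := Real.mul_self_sqrt hm0.le
    have hsq0 : 0 < Real.sqrt m := Real.sqrt_pos.mpr hm0
    -- first piece: the mixed term
    have h1 : |(β₂seq j - β₂) * gsq j * D / y| ≤ 1 / ((-β') * (-β₀)) * (|β₂seq j - β₂| * |D| / m ^ 2) := by
      rw [abs_div, abs_of_pos hy, abs_mul, abs_mul, abs_of_pos hp, div_eq_mul_one_div]
      calc |β₂seq j - β₂| * gsq j * |D| * (1 / y) ≤ |β₂seq j - β₂| * (1 / ((-β') * m)) * |D| * (1 / ((-β₀) * m)) := by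
            gcongr
        _ = 1 / ((-β') * (-β₀)) * (|β₂seq j - β₂| * |D| / m ^ 2) := by field_simp
    -- second piece: the quadratic term and the tails
    have h2 : |β₂ * (D * (gsq j * (D + S₂ + Rm)) / y ^ 2)| ≤
        |β₂| / ((-β') * (-β₀) ^ 2) * (D ^ 2 / m ^ 3) + |β₂| * Δ₀ * s / ((-β') * (-β₀) ^ 2) * (1 / (m * Real.sqrt m)) +
          |β₂| * Δ₀ * r / ((-β') * (-β₀) ^ 2) * (1 / m ^ 2) := by
      rw [abs_mul, abs_div, abs_of_pos (by positivity : 0 < y ^ 2), abs_mul, abs_mul, abs_of_pos hp, div_eq_mul_one_div]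
      have hQ : |D + S₂ + Rm| ≤ |D| + (s * Real.sqrt m + r) := by
        calc |D + S₂ + Rm| ≤ |D + S₂| + |Rm| := abs_add_le _ _
          _ ≤ |D| + |S₂| + |Rm| := by linarith [abs_add_le D S₂]
          _ ≤ _ := by linarith
      have hstep : |D| * (gsq j * |D + S₂ + Rm|) * (1 / y ^ 2) ≤
          |D| * ((1 / ((-β') * m)) * (|D| + (s * Real.sqrt m + r))) * (1 / ((-β₀) * m) ^ 2) := by
        gcongr
      have hexp : |D| * ((1 / ((-β') * m)) * (|D| + (s * Real.sqrt m + r))) * (1 / ((-β₀) * m) ^ 2) =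
          1 / ((-β') * (-β₀) ^ 2) * (|D| * |D| / m ^ 3) + 1 / ((-β') * (-β₀) ^ 2) * (|D| * s * (Real.sqrt m / m ^ 3)) +
            1 / ((-β') * (-β₀) ^ 2) * (|D| * r / m ^ 3) := by
        field_simp
        ring
      have hDD : |D| * |D| = D ^ 2 := by rw [abs_mul_abs_self, sq]
      have hDm' : |D| ≤ Δ₀ * m := hDm
      have hconv : Real.sqrt m / m ^ 3 = 1 / (m ^ 2 * Real.sqrt m) := by
        rw [div_eq_div_iff (by positivity) (by positivity)]
        calc Real.sqrt m * (m ^ 2 * Real.sqrt m) = m ^ 2 * (Real.sqrt m * Real.sqrt m) := by ring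
          _ = 1 * m ^ 3 := by rw [hsq]; ring
      have ht1 : |D| * s * (Real.sqrt m / m ^ 3) ≤ Δ₀ * s * (1 / (m * Real.sqrt m)) := by
        rw [hconv]
        calc |D| * s * (1 / (m ^ 2 * Real.sqrt m)) ≤ Δ₀ * m * s * (1 / (m ^ 2 * Real.sqrt m)) := by gcongr
          _ = Δ₀ * s * (1 / (m * Real.sqrt m)) := by field_simp
      have ht2 : |D| * r / m ^ 3 ≤ Δ₀ * r * (1 / m ^ 2) := by
        have e : Δ₀ * r * (1 / m ^ 2) = Δ₀ * m * r / m ^ 3 := by field_simp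
        rw [e]
        exact div_le_div_of_nonneg_right (mul_le_mul_of_nonneg_right hDm' hr0) (by positivity)
      have hc0 : 0 ≤ 1 / ((-β') * (-β₀) ^ 2) := by positivity
      calc |β₂| * (|D| * (gsq j * |D + S₂ + Rm|) * (1 / y ^ 2))
          ≤ |β₂| * (1 / ((-β') * (-β₀) ^ 2) * (|D| * |D| / m ^ 3) + 1 / ((-β') * (-β₀) ^ 2) * (|D| * s * (Real.sqrt m / m ^ 3)) +
              1 / ((-β') * (-β₀) ^ 2) * (|D| * r / m ^ 3)) := by
            rw [← hexp]; exact mul_le_mul_of_nonneg_left hstep (abs_nonneg _)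
        _ ≤ |β₂| * (1 / ((-β') * (-β₀) ^ 2) * (D ^ 2 / m ^ 3) + 1 / ((-β') * (-β₀) ^ 2) * (Δ₀ * s * (1 / (m * Real.sqrt m))) +
              1 / ((-β') * (-β₀) ^ 2) * (Δ₀ * r * (1 / m ^ 2))) := by
            rw [hDD]
            gcongr
        _ = _ := by ring
    calc _ ≤ |(β₂seq j - β₂) * gsq j * D / y| + |β₂ * (D * (gsq j * (D + S₂ + Rm)) / y ^ 2)| := abs_add_le _ _
      _ ≤ _ := by linarith [h1, h2]
  -- sum the termwise bounds
  have hs1 : ∑ j ∈ range K, 1 / (((K : ℝ) - j) * Real.sqrt ((K : ℝ) - j)) ≤ 3 := by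
    rw [sum_range_reflect_sub (fun x => 1 / (x * Real.sqrt x)) K]; exact sum_inv_mul_sqrt_succ_le K
  have hs2 : ∑ j ∈ range K, 1 / ((K : ℝ) - j) ^ 2 ≤ 2 := by
    rw [sum_range_reflect_sub (fun x => 1 / x ^ 2) K]; exact sum_range_one_div_sq_le_two K
  have hc1 : 0 ≤ 1 / ((-β') * (-β₀)) := by positivity
  have hc2 : 0 ≤ |β₂| / ((-β') * (-β₀) ^ 2) := by positivity
  have hc3 : 0 ≤ |β₂| * Δ₀ * s / ((-β') * (-β₀) ^ 2) := by positivity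
  have hc4 : 0 ≤ |β₂| * Δ₀ * r / ((-β') * (-β₀) ^ 2) := by positivity
  rw [mul_sum, ← sum_sub_distrib]
  calc _ ≤ ∑ j ∈ range K, |β₂seq j * gsq j * (P K - P j) / (1 / g ^ 2 + (-β₀) * ((K : ℝ) - j)) -
          β₂ * ((P K - P j) / (1 / g ^ 2 + (-β₀) * ((K : ℝ) - j)) ^ 2)| := abs_sum_le_sum_abs _ _
    _ ≤ ∑ j ∈ range K, (1 / ((-β') * (-β₀)) * (|β₂seq j - β₂| * |P K - P j| / ((K : ℝ) - j) ^ 2) +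
          |β₂| / ((-β') * (-β₀) ^ 2) * ((P K - P j) ^ 2 / ((K : ℝ) - j) ^ 3) +
          |β₂| * Δ₀ * s / ((-β') * (-β₀) ^ 2) * (1 / (((K : ℝ) - j) * Real.sqrt ((K : ℝ) - j))) +
          |β₂| * Δ₀ * r / ((-β') * (-β₀) ^ 2) * (1 / ((K : ℝ) - j) ^ 2)) := sum_le_sum hterm
    _ = 1 / ((-β') * (-β₀)) * ∑ j ∈ range K, |β₂seq j - β₂| * |P K - P j| / ((K : ℝ) - j) ^ 2 +
          |β₂| / ((-β') * (-β₀) ^ 2) * ∑ j ∈ range K, (P K - P j) ^ 2 / ((K : ℝ) - j) ^ 3 +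
          |β₂| * Δ₀ * s / ((-β') * (-β₀) ^ 2) * ∑ j ∈ range K, 1 / (((K : ℝ) - j) * Real.sqrt ((K : ℝ) - j)) +
          |β₂| * Δ₀ * r / ((-β') * (-β₀) ^ 2) * ∑ j ∈ range K, 1 / ((K : ℝ) - j) ^ 2 := by
        rw [sum_add_distrib, sum_add_distrib, sum_add_distrib, mul_sum, mul_sum, mul_sum, mul_sum]
    _ ≤ 1 / ((-β') * (-β₀)) * Q₁ + |β₂| / ((-β') * (-β₀) ^ 2) * Q₂ +
          |β₂| * Δ₀ * s / ((-β') * (-β₀) ^ 2) * 3 + |β₂| * Δ₀ * r / ((-β') * (-β₀) ^ 2) * 2 := by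
        gcongr
    _ = _ := by
        have hβ'ne : β' ≠ 0 := ne_of_lt hβ'
        have hβ₀ne : β₀ ≠ 0 := ne_of_lt hβ₀
        rw [hs_def, hr_def]
        field_simp
        ring

/-! ## §2 From the line kernel `1∕y_j²` to the integer kernel `1∕(K − j)²` -/

/-- **LINE KERNEL vs INTEGER KERNEL** (pure): for `|D_j| ≤ Δ₀(K − j)` (j < K), `c ≥ 0`, `b₀ > 0`,
`|Σ_{j<K} D_j∕(c + b₀(K − j))² − (1∕b₀²)·Σ_{j<K} D_j∕(K − j)²| ≤ 2Δ₀(c² + 2cb₀)∕b₀⁴` (per term `|1∕y² − 1∕(b₀m)²| ≤ (c² + 2cb₀)∕(b₀⁴m³)` against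
`|D_j| ≤ Δ₀m`, then `Σ 1∕m² ≤ 2`). [folklore] -/
theorem abs_lineKernel_sub_kernel_le {D : ℕ → ℝ} {Δ₀ c b₀ : ℝ} {K : ℕ} (hc : 0 ≤ c) (hb₀ : 0 < b₀) (hΔ0 : 0 ≤ Δ₀)
    (hD : ∀ j, j < K → |D j| ≤ Δ₀ * ((K : ℝ) - j)) :
    |∑ j ∈ range K, D j / (c + b₀ * ((K : ℝ) - j)) ^ 2 - 1 / b₀ ^ 2 * ∑ j ∈ range K, D j / ((K : ℝ) - j) ^ 2| ≤
      2 * (Δ₀ * (c ^ 2 + 2 * c * b₀) / b₀ ^ 4) := by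
  rw [mul_sum, ← sum_sub_distrib]
  have hterm : ∀ j ∈ range K, |D j / (c + b₀ * ((K : ℝ) - j)) ^ 2 - 1 / b₀ ^ 2 * (D j / ((K : ℝ) - j) ^ 2)| ≤
      Δ₀ * (c ^ 2 + 2 * c * b₀) / b₀ ^ 4 * (1 / ((K : ℝ) - j) ^ 2) := by
    intro j hj
    have hjK := mem_range.mp hj
    have hm : (1 : ℝ) ≤ (K : ℝ) - j := by
      have : (j : ℝ) + 1 ≤ K := by exact_mod_cast hjK
      linarith
    have hm0 : (0 : ℝ) < (K : ℝ) - j := by linarith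
    set m := (K : ℝ) - j with hm_def
    have hy : 0 < c + b₀ * m := by positivity
    have e : D j / (c + b₀ * m) ^ 2 - 1 / b₀ ^ 2 * (D j / m ^ 2) =
        -(D j * ((c ^ 2 + 2 * c * b₀ * m) / ((c + b₀ * m) ^ 2 * (b₀ ^ 2 * m ^ 2)))) := by
      field_simp
      ring
    rw [e, abs_neg, abs_mul]
    have hfrac0 : 0 ≤ (c ^ 2 + 2 * c * b₀ * m) / ((c + b₀ * m) ^ 2 * (b₀ ^ 2 * m ^ 2)) := by positivity
    rw [abs_of_nonneg hfrac0]
    have hfrac : (c ^ 2 + 2 * c * b₀ * m) / ((c + b₀ * m) ^ 2 * (b₀ ^ 2 * m ^ 2)) ≤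
        (c ^ 2 + 2 * c * b₀) / b₀ ^ 4 * (1 / m ^ 3) := by
      rw [div_mul_div_comm, mul_one, div_le_div_iff₀ (by positivity) (by positivity)]
      have h1 : c ^ 2 + 2 * c * b₀ * m ≤ (c ^ 2 + 2 * c * b₀) * m := by nlinarith
      have h2 : b₀ ^ 2 * m ^ 2 ≤ (c + b₀ * m) ^ 2 := by nlinarith
      calc (c ^ 2 + 2 * c * b₀ * m) * (b₀ ^ 4 * m ^ 3) ≤ ((c ^ 2 + 2 * c * b₀) * m) * (b₀ ^ 4 * m ^ 3) :=
            mul_le_mul_of_nonneg_right h1 (by positivity)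
        _ = (c ^ 2 + 2 * c * b₀) * (b₀ ^ 2 * m ^ 2) * (b₀ ^ 2 * m ^ 2) := by ring
        _ ≤ (c ^ 2 + 2 * c * b₀) * (c + b₀ * m) ^ 2 * (b₀ ^ 2 * m ^ 2) := by
            have h0 : 0 ≤ c ^ 2 + 2 * c * b₀ := by positivity
            exact mul_le_mul_of_nonneg_right (mul_le_mul_of_nonneg_left h2 h0) (by positivity)
        _ = (c ^ 2 + 2 * c * b₀) * ((c + b₀ * m) ^ 2 * (b₀ ^ 2 * m ^ 2)) := by ring
    calc |D j| * ((c ^ 2 + 2 * c * b₀ * m) / ((c + b₀ * m) ^ 2 * (b₀ ^ 2 * m ^ 2)))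
        ≤ (Δ₀ * m) * ((c ^ 2 + 2 * c * b₀) / b₀ ^ 4 * (1 / m ^ 3)) := mul_le_mul (hD j hjK) hfrac hfrac0 (by positivity)
      _ = Δ₀ * (c ^ 2 + 2 * c * b₀) / b₀ ^ 4 * (1 / m ^ 2) := by field_simp
  calc _ ≤ ∑ j ∈ range K, |D j / (c + b₀ * ((K : ℝ) - j)) ^ 2 - 1 / b₀ ^ 2 * (D j / ((K : ℝ) - j) ^ 2)| :=
        abs_sum_le_sum_abs _ _
    _ ≤ ∑ j ∈ range K, Δ₀ * (c ^ 2 + 2 * c * b₀) / b₀ ^ 4 * (1 / ((K : ℝ) - j) ^ 2) := sum_le_sum hterm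
    _ = Δ₀ * (c ^ 2 + 2 * c * b₀) / b₀ ^ 4 * ∑ j ∈ range K, 1 / ((K : ℝ) - j) ^ 2 := by rw [mul_sum]
    _ ≤ Δ₀ * (c ^ 2 + 2 * c * b₀) / b₀ ^ 4 * 2 := mul_le_mul_of_nonneg_left (sum_inv_sq_le_two K) (by positivity)
    _ = _ := by ring

/-! ## §3 The signed kernel is the harmonic transform of the errors, up to 3Δ₀ -/

/-- The SHARP upper tail weight (companion of (D4-J14b) `le_weight`): `Σ_{j≤i} 1∕(K − j)² ≤ 1∕(K − i)² + 1∕(K − i) − 1∕K` for `i < K`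
(`1∕m² ≤ 1∕(m(m−1))` telescoping; by induction as in (D4-J14b)). [folklore] -/
theorem weight_le_sharp {K : ℕ} : ∀ {i : ℕ}, i < K →
    ∑ j ∈ range (i + 1), 1 / ((K : ℝ) - j) ^ 2 ≤ 1 / ((K : ℝ) - i) ^ 2 + (1 / ((K : ℝ) - i) - 1 / (K : ℝ)) := by
  intro i
  induction i with
  | zero =>
      intro hK
      simp
  | succ i ih =>
      intro hK
      have hi : i < K := Nat.lt_of_succ_lt hK
      have h := ih hi
      rw [sum_range_succ]
      have ha : (2 : ℝ) ≤ (K : ℝ) - i := by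
        have : (i : ℝ) + 2 ≤ K := by exact_mod_cast hK
        linarith
      have e : ((K : ℝ) - ((i + 1 : ℕ) : ℝ)) = (K : ℝ) - i - 1 := by push_cast; ring
      rw [e]
      have key : 1 / ((K : ℝ) - i) ^ 2 + 1 / ((K : ℝ) - i) ≤ 1 / ((K : ℝ) - i - 1) := by
        rw [div_add_div _ _ (by positivity) (by positivity), div_le_div_iff₀ (by positivity) (by linarith)]
        nlinarith
      linarith

/-- The tail weight is `1∕(K − i)` up to `1∕(K − i)² + 1∕(K + 1)`: `|Σ_{j≤i} 1∕(K − j)² − 1∕(K − i)| ≤ 1∕(K − i)² + 1∕(K + 1)` (`i < K`; lower half =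
(D4-J14b) `le_weight`). [folklore] -/
theorem abs_weight_sub_inv_le {K i : ℕ} (hi : i < K) :
    |∑ j ∈ range (i + 1), 1 / ((K : ℝ) - j) ^ 2 - 1 / ((K : ℝ) - i)| ≤ 1 / ((K : ℝ) - i) ^ 2 + 1 / ((K : ℝ) + 1) := by
  have h1 := weight_le_sharp hi
  have h2 := le_weight hi
  have hK : (0 : ℝ) < K := by exact_mod_cast (Nat.zero_lt_of_lt hi)
  have h3 : 0 ≤ 1 / (K : ℝ) := by positivity
  have h4 : 0 ≤ 1 / ((K : ℝ) + 1) := by positivity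
  have h5 : 0 ≤ 1 / ((K : ℝ) - i) ^ 2 := by positivity
  rw [abs_le]; constructor <;> linarith

/-- **THE SIGNED KERNEL IS THE HARMONIC TRANSFORM.**  For ANY real sequence δ with `|δ_i| ≤ Δ₀`:
`|Σ_{j<K} (Σ_{i<K} δ_i − Σ_{i<j} δ_i)∕(K − j)² − Σ_{i<K} δ_i∕(K − i)| ≤ 3Δ₀` — Fubini ((D4-J14b) `kernel_eq_weighted`, valid for signed sequences) and the
weight estimate above, `Σ 1∕(K − i)² ≤ 2`, `K∕(K + 1) ≤ 1`. [folklore] -/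
theorem abs_signedKernel_sub_harmonic_le {δ : ℕ → ℝ} {Δ₀ : ℝ} (hδ : ∀ i, |δ i| ≤ Δ₀) (K : ℕ) :
    |∑ j ∈ range K, (∑ i ∈ range K, δ i - ∑ i ∈ range j, δ i) / ((K : ℝ) - j) ^ 2 -
        ∑ i ∈ range K, δ i / ((K : ℝ) - i)| ≤ 3 * Δ₀ := by
  have hΔ : 0 ≤ Δ₀ := le_trans (abs_nonneg _) (hδ 0)
  rw [kernel_eq_weighted, ← sum_sub_distrib]
  have hterm : ∀ i ∈ range K, |δ i * ∑ j ∈ range (i + 1), 1 / ((K : ℝ) - j) ^ 2 - δ i / ((K : ℝ) - i)| ≤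
      Δ₀ * (1 / ((K : ℝ) - i) ^ 2 + 1 / ((K : ℝ) + 1)) := by
    intro i hi
    have hiK := mem_range.mp hi
    rw [div_eq_mul_one_div (δ i), ← mul_sub, abs_mul]
    exact mul_le_mul (hδ i) (abs_weight_sub_inv_le hiK) (abs_nonneg _) hΔ
  calc _ ≤ ∑ i ∈ range K, |δ i * ∑ j ∈ range (i + 1), 1 / ((K : ℝ) - j) ^ 2 - δ i / ((K : ℝ) - i)| :=
        abs_sum_le_sum_abs _ _
    _ ≤ ∑ i ∈ range K, Δ₀ * (1 / ((K : ℝ) - i) ^ 2 + 1 / ((K : ℝ) + 1)) := sum_le_sum hterm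
    _ = Δ₀ * (∑ i ∈ range K, 1 / ((K : ℝ) - i) ^ 2 + ∑ i ∈ range K, 1 / ((K : ℝ) + 1)) := by
        rw [← mul_sum, sum_add_distrib]
    _ ≤ Δ₀ * (2 + 1) := by
        apply mul_le_mul_of_nonneg_left _ hΔ
        have hs2 := sum_inv_sq_le_two K
        have hs1 : ∑ i ∈ range K, 1 / ((K : ℝ) + 1) ≤ 1 := by
          rw [sum_const, card_range, nsmul_eq_mul, mul_one_div, div_le_one (by positivity)]
          linarith
        linarith
    _ = 3 * Δ₀ := by ring

end Summit.QuantumFields.BalabanUV.Beta.RemainderExplicitLinearizationDefectSigned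

end
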